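import Literature.Barriers.AtomisticToContinuum.NoBVEstimatesMultiDFieldBounds
import HarnessLib

/-!
# The uniform-in-`δ` energy inequality `|d/dt ⟪S Y_α, Y_α⟫| ≤ C E` for the regularised
# quasilinear flow

Brick B-δ, §4b (flow layer), of the Kato existence programme for the symmetrizable branch of
Rauch's Local Existence Theorem (towards `Rauch1986_smallAmplitudeExpansionL2`). Along a solution
`U` of the Friedrichs-regularised cut-off quasilinear system `U' = F_δ(U) = -ρ_δ ⋆ G(ρ_δ ⋆ U)`
(`NoBVEstimatesMultiDRegField.lean`), with derived curves `Y_α` (`ρ_δ ⋆ Y_α = ∂_α(ρ_δ ⋆ U)`,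
`NoBVEstimatesMultiDDerivedCurves.lean`) and the symmetrizer weight `S = s(ρ_δ ⋆ U)`
(`NoBVEstimatesMultiDEnergyIdentity.lean`), the time derivative of one weighted energy summand
is `⟪S'Y_α, Y_α⟫ + 2⟪S F_δ^{(α)}(U), Y_α⟫` (`hasDerivAt_weightedTerm`). This file proves the
heart of the energy method [Majda1984, Ch. 2, Thm 2.1, (2.13)–(2.15)], [TaylorPDEIII2011, Ch. 16,
§1 (1.11)–(1.13), §2]:

* `inner_weightOp_derivedField_eq` — moving the mollifier and the weight across the pairing:
  `⟪S F_δ^{(α)}(U), Y_α⟫ = -∫ ⟪∂_α G(W), s(W) ∂_αW⟫ + ∫ ⟪[ρ_δ⋆, s(W)] ∂_αG(W), Y_α⟫`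
  (`W = ρ_δ ⋆ U`; self-adjointness of `S` and of `ρ_δ ⋆`, the key identity);
* `abs_integral_commutator_le` — the commutator term costs `δ ‖D(s∘W)‖_∞ ‖∂_αG(W)‖₂ ‖Y_α‖`
  (tree: `l2norm_commutator_moll_le`), which is `O(E)` because `‖∂_αG(W)‖₂ = O(δ⁻¹ E^{1/2})`;
* `abs_integral_top_le` — the top-order term `∫ ⟪aⱼ(W)∂ⱼ∂_αW, s(W)∂_αW⟫` is `O(‖∂_αW‖₂²)` by
  the symmetry of `s aⱼ` and one integration by parts (tree: `abs_integral_inner_clm_fderiv_le`);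
* `energy_term_bound_at`, `exists_energy_deriv_bound` — **the uniform energy inequality**: there
  is `C`, depending only on the coefficients, `d`, `k` and the order `m ≥ 4(d+1)`, such that for
  EVERY `δ ∈ (0, 1]`, every datum and every time with `E(t) = Σ_{|α| ≤ m} ‖Y_α(t)‖² ≤ 1`:
  `|⟪S'Y_α, Y_α⟫ + 2⟪S F_δ^{(α)}(U), Y_α⟫| ≤ C · E(t)` for all `|α| ≤ m`.

Everything is proved; no named fact and no `sorry` is introduced.

## References

* [Majda1984] A. Majda, *Compressible Fluid Flow and Systems of Conservation Laws in Several
  Space Variables* (1984), Ch. 2, §2.1, Thm 2.1, (2.13)–(2.15).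
* [TaylorPDEIII2011] M. E. Taylor, *Partial Differential Equations III*, 2nd ed. (2011), Ch. 16,
  §1 (1.11)–(1.13) and §2.
-/

noncomputable section

open MeasureTheory Set Function Filter Metric ContinuousLinearMap
open scoped ContDiff Topology ENNReal NNReal Convolution RealInnerProductSpace

namespace Literature.Barriers.AtomisticToContinuum

open Literature.Analysis.PDE Literature.Analysis.FunctionSpaces Literature.Analysis.ODE

variable {d k : ℕ}

variable {M L : ℝ} {a : Fin d → (EuclideanSpace ℝ (Fin k)) → ((EuclideanSpace ℝ (Fin k)) →L[ℝ] (EuclideanSpace ℝ (Fin k)))} {b : (EuclideanSpace ℝ (Fin k)) → (EuclideanSpace ℝ (Fin k))}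
  {s : (EuclideanSpace ℝ (Fin k)) → ((EuclideanSpace ℝ (Fin k)) →L[ℝ] (EuclideanSpace ℝ (Fin k)))} {u₀ : (EuclideanSpace ℝ (Fin d)) → (EuclideanSpace ℝ (Fin k))}

/-! ### Moving the mollifier and the weight across the pairing -/

/-- The values of the weight applied to `Y`: `(S(ρ_δ ⋆ V) Y)(x) = s((ρ_δ ⋆ V)(x)) Y(x)` a.e.
[folklore] -/
theorem coeFn_weightOp (hS : IsSymmSmoothCoeff M L a b s) {δ : ℝ} (hδ : 0 < δ)
    (V Y : Lp (EuclideanSpace ℝ (Fin k)) 2 (volume : Measure (EuclideanSpace ℝ (Fin d)))) :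
    (weightOp hS hδ V Y : (EuclideanSpace ℝ (Fin d)) → (EuclideanSpace ℝ (Fin k))) =ᵐ[(volume : Measure (EuclideanSpace ℝ (Fin d)))]
      fun x => s (smoothRep (moll (Fin d) hδ) V x) (Y x) :=
  coeFn_mulL2 _ _ Y

/-- **The derived field against an `L²` element**:
`⟪F_δ^{(α)}(V), Z⟫ = -∫ ⟪(ρ_δ ⋆ ∂_αG(ρ_δ ⋆ V))(x), Z(x)⟫ dx` (the word derivative moved from the
kernel onto the smooth field `G`). [cite: TaylorPDEIII2011, Ch. 16 §1, (1.10)] -/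
theorem inner_derivedField_eq (hS : IsSymmSmoothCoeff M L a b s) {δ : ℝ} (hδ : 0 < δ)
    (α : List (Fin d)) (V Z : Lp (EuclideanSpace ℝ (Fin k)) 2 (volume : Measure (EuclideanSpace ℝ (Fin d)))) :
    ⟪derivedField hS.toIsTameCoeff hδ α V, Z⟫ =
      -∫ x, ⟪(moll (Fin d) hδ ⋆[lsmul ℝ ℝ, volume]
        cwd α (gfield a b (smoothRep (moll (Fin d) hδ) V))) x, (Z : (EuclideanSpace ℝ (Fin d)) → (EuclideanSpace ℝ (Fin k))) x⟫ := by
  set ρ := moll (Fin d) hδ with hρ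
  set G := gfield a b (smoothRep ρ V) with hG
  have hGs : ContDiff ℝ ∞ G :=
    contDiff_gfield hS (contDiff_smoothRep (contDiff_moll hδ) (hasCompactSupport_moll hδ) V)
  have hGm : MemLp G 2 (volume : Measure (EuclideanSpace ℝ (Fin d))) := (memLp_gfield_smoothRep hS.toIsTameCoeff hδ V).1
  have hGl : LocallyIntegrable G (volume : Measure (EuclideanSpace ℝ (Fin d))) := hGm.locallyIntegrable one_le_two
  have hker : cwd α ρ ⋆[lsmul ℝ ℝ, volume] G = ρ ⋆[lsmul ℝ ℝ, volume] cwd α G := by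
    rw [← cwd_convolution_eq_convolution_cwd_kernel (contDiff_moll hδ) (hasCompactSupport_moll hδ)
      hGl, cwd_convolution_eq_convolution_cwd (continuous_moll hδ) (hasCompactSupport_moll hδ) hGs]
  rw [derivedField, inner_neg_left, L2.inner_def]
  congr 1
  refine integral_congr_ae ?_
  filter_upwards [coeFn_convL2 (continuous_cwd_moll hδ α) (hasCompactSupport_cwd_moll hδ α)
    (hGm.toLp G)] with x hx
  change ⟪(convL2 (cwd α ρ) (continuous_cwd_moll hδ α) (hasCompactSupport_cwd_moll hδ α)
    (hGm.toLp G) : (EuclideanSpace ℝ (Fin d)) → (EuclideanSpace ℝ (Fin k))) x, (Z : (EuclideanSpace ℝ (Fin d)) → (EuclideanSpace ℝ (Fin k))) x⟫ = _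
  rw [hx, convolution_kernel_congr_ae (MemLp.coeFn_toLp hGm), hker]

/-- **`⟪S F_δ^{(α)}(U), Y_α⟫ = -∫ ⟪∂_αG(W), s(W) ∂_αW⟫ + ∫ ⟪[ρ_δ⋆, s(W)] ∂_αG(W), Y_α⟫`**
along the flow (`W = ρ_δ ⋆ U(t)`): `S` is self-adjoint, the derived field is `-ρ_δ ⋆ ∂_αG(W)`,
`ρ_δ ⋆` is self-adjoint, and `ρ_δ ⋆ Y_α = ∂_αW`. [cite: Majda1984, Ch. 2 §2.1, (2.13)];
[cite: TaylorPDEIII2011, Ch. 16 §1, (1.11)] -/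
theorem inner_weightOp_derivedField_eq (hS : IsSymmSmoothCoeff M L a b s) {δ : ℝ} (hδ : 0 < δ)
    (hu₀ : ContDiff ℝ ∞ u₀) (hu₀c : HasCompactSupport u₀)
    {U : ℝ → Lp (EuclideanSpace ℝ (Fin k)) 2 (volume : Measure (EuclideanSpace ℝ (Fin d)))} (hU0 : U 0 = dataL2 hu₀ hu₀c)
    (hU : ∀ t, HasDerivAt U (regField hS.toIsTameCoeff hδ (U t)) t) (α : List (Fin d)) (t : ℝ)
    {K₀ Ls : ℝ} (hK₀ : ∀ y, ‖s y‖ ≤ K₀)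
    (hLs : ∀ x, ‖fderiv ℝ (fun y => s (smoothRep (moll (Fin d) hδ) (U t) y)) x‖ ≤ Ls)
    (hg : MemLp (cwd α (gfield a b (smoothRep (moll (Fin d) hδ) (U t)))) 2 (volume : Measure (EuclideanSpace ℝ (Fin d)))) :
    ⟪weightOp hS hδ (U t) (derivedField hS.toIsTameCoeff hδ α (U t)),
        dcurve hS.toIsTameCoeff hδ hu₀ hu₀c U α t⟫ =
      -(∫ x, ⟪cwd α (gfield a b (smoothRep (moll (Fin d) hδ) (U t))) x,
          s (smoothRep (moll (Fin d) hδ) (U t) x) (cwd α (smoothRep (moll (Fin d) hδ) (U t)) x)⟫) +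
      ∫ x, ⟪(moll (Fin d) hδ ⋆[lsmul ℝ ℝ, volume] fun y => s (smoothRep (moll (Fin d) hδ) (U t) y)
            (cwd α (gfield a b (smoothRep (moll (Fin d) hδ) (U t))) y)) x -
          s (smoothRep (moll (Fin d) hδ) (U t) x) ((moll (Fin d) hδ ⋆[lsmul ℝ ℝ, volume]
            cwd α (gfield a b (smoothRep (moll (Fin d) hδ) (U t)))) x),
        (dcurve hS.toIsTameCoeff hδ hu₀ hu₀c U α t : (EuclideanSpace ℝ (Fin d)) → (EuclideanSpace ℝ (Fin k))) x⟫ := by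
  set ρ := moll (Fin d) hδ with hρ
  set Wt := smoothRep ρ (U t) with hWt
  set G := gfield a b Wt with hG
  set g := cwd α G with hgdef
  set Y := dcurve hS.toIsTameCoeff hδ hu₀ hu₀c U α t with hYdef
  set V := cwd α Wt with hVdef
  have hK₀0 : 0 ≤ K₀ := (norm_nonneg _).trans (hK₀ 0)
  have hV : smoothRep ρ Y = V := smoothRep_dcurve hS.toIsTameCoeff hδ hu₀ hu₀c hU0 hU α t
  have hWs : ContDiff ℝ ∞ Wt := contDiff_smoothRep (contDiff_moll hδ) (hasCompactSupport_moll hδ) _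
  have hsWc1 : ContDiff ℝ 1 (fun y => s (Wt y)) :=
    (contDiff_s_comp hS hWs).of_le (by exact_mod_cast le_top)
  have hgc : Continuous g := continuous_cwd (contDiff_gfield hS hWs) α
  -- move `S` to the other side and unfold the derived field
  rw [inner_weightOp_comm, inner_derivedField_eq hS hδ α (U t) (weightOp hS hδ (U t) Y)]
  -- the weight acts pointwise
  have h3 : ∫ x, ⟪(ρ ⋆[lsmul ℝ ℝ, volume] g) x, (weightOp hS hδ (U t) Y : (EuclideanSpace ℝ (Fin d)) → (EuclideanSpace ℝ (Fin k))) x⟫ =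
      ∫ x, ⟪(ρ ⋆[lsmul ℝ ℝ, volume] g) x, s (Wt x) ((Y : (EuclideanSpace ℝ (Fin d)) → (EuclideanSpace ℝ (Fin k))) x)⟫ :=
    integral_congr_ae (by
      filter_upwards [coeFn_weightOp hS hδ (U t) Y] with x hx
      rw [hx])
  -- square integrability of everybody
  have hρg : MemLp (ρ ⋆[lsmul ℝ ℝ, volume] g) 2 (volume : Measure (EuclideanSpace ℝ (Fin d))) :=
    (memLp_convolution_kernel (continuous_moll hδ) (hasCompactSupport_moll hδ) hg).1
  obtain ⟨hsg, -⟩ := memLp_clm_apply_and_l2norm_le hsWc1.continuous hgc hg hK₀0 (fun x => hK₀ _)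
  have hρsg : MemLp (ρ ⋆[lsmul ℝ ℝ, volume] fun y => s (Wt y) (g y)) 2 (volume : Measure (EuclideanSpace ℝ (Fin d))) :=
    (memLp_convolution_kernel (continuous_moll hδ) (hasCompactSupport_moll hδ) hsg).1
  obtain ⟨hcomm, -⟩ := l2norm_commutator_moll_le δ hδ hsWc1 (fun x => hK₀ _) hLs hgc hg
  have hY2 : MemLp (Y : (EuclideanSpace ℝ (Fin d)) → (EuclideanSpace ℝ (Fin k))) 2 (volume : Measure (EuclideanSpace ℝ (Fin d))) := Lp.memLp Y
  -- pointwise: `⟪ρ⋆g, s Y⟫ = ⟪ρ⋆(s g), Y⟫ - ⟪commutator, Y⟫`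
  have h4 : ∀ x, ⟪(ρ ⋆[lsmul ℝ ℝ, volume] g) x, s (Wt x) ((Y : (EuclideanSpace ℝ (Fin d)) → (EuclideanSpace ℝ (Fin k))) x)⟫ =
      ⟪(ρ ⋆[lsmul ℝ ℝ, volume] fun y => s (Wt y) (g y)) x, (Y : (EuclideanSpace ℝ (Fin d)) → (EuclideanSpace ℝ (Fin k))) x⟫ -
      ⟪(ρ ⋆[lsmul ℝ ℝ, volume] fun y => s (Wt y) (g y)) x -
          s (Wt x) ((ρ ⋆[lsmul ℝ ℝ, volume] g) x), (Y : (EuclideanSpace ℝ (Fin d)) → (EuclideanSpace ℝ (Fin k))) x⟫ := by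
    intro x
    rw [inner_sub_left, ← hS.symm_s]
    ring
  have h5 : ∫ x, ⟪(ρ ⋆[lsmul ℝ ℝ, volume] g) x, s (Wt x) ((Y : (EuclideanSpace ℝ (Fin d)) → (EuclideanSpace ℝ (Fin k))) x)⟫ =
      (∫ x, ⟪(ρ ⋆[lsmul ℝ ℝ, volume] fun y => s (Wt y) (g y)) x, (Y : (EuclideanSpace ℝ (Fin d)) → (EuclideanSpace ℝ (Fin k))) x⟫) -
        ∫ x, ⟪(ρ ⋆[lsmul ℝ ℝ, volume] fun y => s (Wt y) (g y)) x -
          s (Wt x) ((ρ ⋆[lsmul ℝ ℝ, volume] g) x), (Y : (EuclideanSpace ℝ (Fin d)) → (EuclideanSpace ℝ (Fin k))) x⟫ := by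
    rw [← integral_sub (integrable_inner_of_memLp hρsg hY2) (integrable_inner_of_memLp hcomm hY2)]
    exact integral_congr_ae (Eventually.of_forall h4)
  -- self-adjointness of `ρ ⋆`, then `ρ ⋆ Y = V` and the symmetry of `s`
  have h6 : ∫ x, ⟪(ρ ⋆[lsmul ℝ ℝ, volume] fun y => s (Wt y) (g y)) x, (Y : (EuclideanSpace ℝ (Fin d)) → (EuclideanSpace ℝ (Fin k))) x⟫ =
      ∫ x, ⟪s (Wt x) (g x), (ρ ⋆[lsmul ℝ ℝ, volume] (Y : (EuclideanSpace ℝ (Fin d)) → (EuclideanSpace ℝ (Fin k)))) x⟫ :=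
    (integral_inner_convolution_kernel_comm (continuous_moll hδ) (hasCompactSupport_moll hδ)
      (moll_neg hδ) hsg hY2).symm
  have h7 : ∫ x, ⟪s (Wt x) (g x), (ρ ⋆[lsmul ℝ ℝ, volume] (Y : (EuclideanSpace ℝ (Fin d)) → (EuclideanSpace ℝ (Fin k)))) x⟫ =
      ∫ x, ⟪g x, s (Wt x) (V x)⟫ := by
    refine integral_congr_ae (Eventually.of_forall fun x => ?_)
    change ⟪s (Wt x) (g x), smoothRep ρ Y x⟫ = ⟪g x, s (Wt x) (V x)⟫
    rw [hV, hS.symm_s]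
  rw [h3, h5, h6, h7]
  ring

/-- **The commutator term**: `|∫ ⟪[ρ_δ⋆, s(W)] g, Y⟫| ≤ δ L_s ‖g‖₂ ‖Y‖` for a continuous
`g ∈ L²`, where `L_s` bounds `‖D(s∘W)‖`. [cite: TaylorPDEIII2011, Ch. 16 §1, (1.13)] -/
theorem abs_integral_commutator_le (hS : IsSymmSmoothCoeff M L a b s) {δ : ℝ} (hδ : 0 < δ)
    {w : (EuclideanSpace ℝ (Fin d)) → (EuclideanSpace ℝ (Fin k))} (hw : ContDiff ℝ ∞ w) {K₀ Ls : ℝ} (hK₀ : ∀ y, ‖s y‖ ≤ K₀)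
    (hLs : ∀ x, ‖fderiv ℝ (fun y => s (w y)) x‖ ≤ Ls) {g : (EuclideanSpace ℝ (Fin d)) → (EuclideanSpace ℝ (Fin k))} (hgc : Continuous g)
    (hg : MemLp g 2 (volume : Measure (EuclideanSpace ℝ (Fin d)))) (Y : Lp (EuclideanSpace ℝ (Fin k)) 2 (volume : Measure (EuclideanSpace ℝ (Fin d)))) :
    |∫ x, ⟪(moll (Fin d) hδ ⋆[lsmul ℝ ℝ, volume] fun y => s (w y) (g y)) x -
        s (w x) ((moll (Fin d) hδ ⋆[lsmul ℝ ℝ, volume] g) x), (Y : (EuclideanSpace ℝ (Fin d)) → (EuclideanSpace ℝ (Fin k))) x⟫| ≤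
      δ * Ls * l2norm g * ‖Y‖ := by
  have hsWc1 : ContDiff ℝ 1 (fun y => s (w y)) := (contDiff_s_comp hS hw).of_le (by exact_mod_cast le_top)
  obtain ⟨hcomm, hle⟩ := l2norm_commutator_moll_le δ hδ hsWc1 (fun x => hK₀ _) hLs hgc hg
  have hYn : l2norm (Y : (EuclideanSpace ℝ (Fin d)) → (EuclideanSpace ℝ (Fin k))) = ‖Y‖ := by rw [l2norm_def, Lp.norm_def]
  calc |∫ x, ⟪(moll (Fin d) hδ ⋆[lsmul ℝ ℝ, volume] fun y => s (w y) (g y)) x -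
          s (w x) ((moll (Fin d) hδ ⋆[lsmul ℝ ℝ, volume] g) x), (Y : (EuclideanSpace ℝ (Fin d)) → (EuclideanSpace ℝ (Fin k))) x⟫|
      ≤ l2norm (fun x => (moll (Fin d) hδ ⋆[lsmul ℝ ℝ, volume] fun y => s (w y) (g y)) x -
          s (w x) ((moll (Fin d) hδ ⋆[lsmul ℝ ℝ, volume] g) x)) * l2norm (Y : (EuclideanSpace ℝ (Fin d)) → (EuclideanSpace ℝ (Fin k))) :=
        abs_integral_inner_le_l2norm hcomm (Lp.memLp Y)
    _ ≤ δ * Ls * l2norm g * ‖Y‖ := by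
        rw [hYn]
        exact mul_le_mul_of_nonneg_right hle (norm_nonneg _)

/-! ### The top-order and the lower-order parts of the main term -/

/-- **The top-order term**: `|∫ ⟪aⱼ(w)∂_α∂ⱼw, s(w)∂_αw⟫| ≤ (M_P/2) ‖∂_αw‖₂²`, `M_P` a `C¹`
bound of the symmetric field `Pⱼ = s(w)aⱼ(w)` — symmetry of `s aⱼ` and one integration by parts.
[cite: Majda1984, Ch. 2 §2.1, (2.13)]; [cite: TaylorPDEIII2011, Ch. 16 §1, (1.12)] -/
theorem abs_integral_top_le (hS : IsSymmSmoothCoeff M L a b s) {w : (EuclideanSpace ℝ (Fin d)) → (EuclideanSpace ℝ (Fin k))}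
    (hw : ContDiff ℝ ∞ w) {K₀ Cs1 Ca1 : ℝ} (hK₀ : ∀ y, ‖s y‖ ≤ K₀) (j : Fin d)
    (hCs1 : ∀ x, ‖cwd [j] (fun y => s (w y)) x‖ ≤ Cs1)
    (hCa1 : ∀ x, ‖cwd [j] (fun y => a j (w y)) x‖ ≤ Ca1) {α : List (Fin d)}
    (hV2 : MemLp (cwd α w) 2 (volume : Measure (EuclideanSpace ℝ (Fin d))))
    (hVj : MemLp (cwd (j :: α) w) 2 (volume : Measure (EuclideanSpace ℝ (Fin d)))) :
    |∫ x, ⟪a j (w x) (cwd α (cwd [j] w) x), s (w x) (cwd α w x)⟫| ≤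
      (K₀ * M + (Cs1 * M + K₀ * Ca1)) / 2 * l2norm (cwd α w) ^ 2 := by
  have hK₀0 : 0 ≤ K₀ := (norm_nonneg _).trans (hK₀ 0)
  have hCs10 : 0 ≤ Cs1 := (norm_nonneg _).trans (hCs1 0)
  have hCa10 : 0 ≤ Ca1 := (norm_nonneg _).trans (hCa1 0)
  have hM0 : 0 ≤ M := hS.M_nonneg
  set V := cwd α w with hV
  set P : (EuclideanSpace ℝ (Fin d)) → ((EuclideanSpace ℝ (Fin k)) →L[ℝ] (EuclideanSpace ℝ (Fin k))) := fun x => (s (w x)).comp (a j (w x)) with hP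
  have hperm : cwd α (cwd [j] w) = fun x => fderiv ℝ V x (bv j) := by
    rw [← cwd_append, cwd_perm hw List.perm_append_comm]
    rfl
  have hpt : ∀ x, ⟪a j (w x) (fderiv ℝ V x (bv j)), s (w x) (V x)⟫ =
      ⟪V x, P x (fderiv ℝ V x (bv j))⟫ := fun x => by
    rw [← hS.symm_s, real_inner_comm]
    rfl
  rw [hperm]
  simp_rw [hpt]
  have hM0' : ∀ x, ‖P x‖ ≤ K₀ * M + (Cs1 * M + K₀ * Ca1) := fun x =>
    (norm_sa_comp_le hS hK₀ j x).trans (le_add_of_nonneg_right (by positivity))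
  have hM1' : ∀ x, ‖fderiv ℝ P x (bv j)‖ ≤ K₀ * M + (Cs1 * M + K₀ * Ca1) := fun x =>
    (norm_fderiv_sa_comp_le hS hw hK₀ j j hCs1 hCa1 x).trans (le_add_of_nonneg_left (by positivity))
  have hVj' : MemLp (fun x => fderiv ℝ V x (bv j)) 2 (volume : Measure (EuclideanSpace ℝ (Fin d))) := hVj
  exact abs_integral_inner_clm_fderiv_le ((contDiff_sa_comp hS hw j).of_le (by exact_mod_cast le_top))
    (inner_sa_comp_comm hS j) hM0' j hM1' ((contDiff_cwd hw α).of_le (by exact_mod_cast le_top))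
    hV2 hVj'

/-- **A lower-order pairing**: `|∫ ⟪f, s(w) V⟫| ≤ ‖f‖₂ K₀ ‖V‖₂`. [folklore] -/
theorem abs_integral_inner_s_le (hS : IsSymmSmoothCoeff M L a b s) {w : (EuclideanSpace ℝ (Fin d)) → (EuclideanSpace ℝ (Fin k))}
    (hw : ContDiff ℝ ∞ w) {K₀ : ℝ} (hK₀ : ∀ y, ‖s y‖ ≤ K₀) {f V : (EuclideanSpace ℝ (Fin d)) → (EuclideanSpace ℝ (Fin k))}
    (hf : MemLp f 2 (volume : Measure (EuclideanSpace ℝ (Fin d)))) (hVc : Continuous V)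
    (hV : MemLp V 2 (volume : Measure (EuclideanSpace ℝ (Fin d)))) :
    |∫ x, ⟪f x, s (w x) (V x)⟫| ≤ l2norm f * (K₀ * l2norm V) := by
  have hK₀0 : 0 ≤ K₀ := (norm_nonneg _).trans (hK₀ 0)
  obtain ⟨hsV, hle⟩ := memLp_clm_apply_and_l2norm_le ((contDiff_s_comp hS hw).continuous) hVc hV
    hK₀0 (fun x => hK₀ _)
  exact (abs_integral_inner_le_l2norm hf hsV).trans (mul_le_mul_of_nonneg_left hle (l2norm_nonneg _))

/-! ### Controls of `W = ρ_δ ⋆ U(t)` by the energy `E(t) = Σ_{|α| ≤ m} ‖Y_α(t)‖²` -/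

section Controls

variable (h : IsTameCoeff M L a b) {δ : ℝ} (hδ : 0 < δ) (hu₀ : ContDiff ℝ ∞ u₀)
  (hu₀c : HasCompactSupport u₀) {U : ℝ → Lp (EuclideanSpace ℝ (Fin k)) 2 (volume : Measure (EuclideanSpace ℝ (Fin d)))}

/-- **Sup control**: `‖∂_c W(t)(x)‖ ≤ (C_sob E(t))^{1/2}` for `|c| + 2(d+1) ≤ m`. [folklore] -/
theorem norm_cwd_smoothRep_flow_le_sqrt (hU0 : U 0 = dataL2 hu₀ hu₀c)
    (hU : ∀ t, HasDerivAt U (regField h hδ (U t)) t) {m : ℕ} (c : List (Fin d))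
    (hc : c.length + 2 * (d + 1) ≤ m) (t : ℝ) (x : EuclideanSpace ℝ (Fin d)) :
    ‖cwd c (smoothRep (moll (Fin d) hδ) (U t)) x‖ ≤ Real.sqrt (supConst (Fin d) (EuclideanSpace ℝ (Fin k)) *
      ∑ α ∈ wordsLE (Fin d) m, ‖dcurve h hδ hu₀ hu₀c U α t‖ ^ 2) := by
  have h1 := norm_cwd_smoothRep_flow_sq_le_energy h hδ hu₀ hu₀c hU0 hU c hc t x
  have h2 := Real.abs_le_sqrt h1
  rwa [abs_of_nonneg (norm_nonneg _)] at h2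

/-- **`L²` control**: `‖∂_c W(t)‖₂ ≤ E(t)^{1/2}` for `|c| ≤ m`. [folklore] -/
theorem l2norm_cwd_smoothRep_flow_le_sqrt (hU0 : U 0 = dataL2 hu₀ hu₀c)
    (hU : ∀ t, HasDerivAt U (regField h hδ (U t)) t) {m : ℕ} (c : List (Fin d))
    (hc : c.length ≤ m) (t : ℝ) :
    MemLp (cwd c (smoothRep (moll (Fin d) hδ) (U t))) 2 (volume : Measure (EuclideanSpace ℝ (Fin d))) ∧
      l2norm (cwd c (smoothRep (moll (Fin d) hδ) (U t))) ≤
        Real.sqrt (∑ α ∈ wordsLE (Fin d) m, ‖dcurve h hδ hu₀ hu₀c U α t‖ ^ 2) := by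
  obtain ⟨hm, hle⟩ := l2norm_cwd_smoothRep_flow_le h hδ hu₀ hu₀c hU0 hU c t
  refine ⟨hm, hle.trans ?_⟩
  have h1 : ‖dcurve h hδ hu₀ hu₀c U c t‖ ^ 2 ≤ ∑ α ∈ wordsLE (Fin d) m, ‖dcurve h hδ hu₀ hu₀c U α t‖ ^ 2 :=
    Finset.single_le_sum (f := fun α => ‖dcurve h hδ hu₀ hu₀c U α t‖ ^ 2) (fun _ _ => sq_nonneg _)
      (mem_wordsLE.2 hc)
  have h2 := Real.abs_le_sqrt h1
  rwa [abs_of_nonneg (norm_nonneg _)] at h2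

/-- The sum `K_D = Σⱼ C₁(j)` of the derivative costs of the unit mollifier. [folklore] -/
theorem mollDerivConst_le_sum (j : Fin d) :
    mollDerivConst (Fin d) (bv j) ≤ ∑ i : Fin d, mollDerivConst (Fin d) (bv i) :=
  Finset.single_le_sum (f := fun i => mollDerivConst (Fin d) (bv i))
    (fun i _ => mollDerivConst_nonneg (bv i)) (Finset.mem_univ j)

/-- **`L²` control of one more derivative**: `‖∂ⱼ∂_c W(t)‖₂ ≤ (K_D/δ) E(t)^{1/2}` for `|c| ≤ m`.
[folklore] -/
theorem l2norm_cwd_cons_smoothRep_flow_le_sqrt (hU0 : U 0 = dataL2 hu₀ hu₀c)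
    (hU : ∀ t, HasDerivAt U (regField h hδ (U t)) t) {m : ℕ} (j : Fin d) (c : List (Fin d))
    (hc : c.length ≤ m) (t : ℝ) :
    MemLp (cwd (j :: c) (smoothRep (moll (Fin d) hδ) (U t))) 2 (volume : Measure (EuclideanSpace ℝ (Fin d))) ∧
      l2norm (cwd (j :: c) (smoothRep (moll (Fin d) hδ) (U t))) ≤
        (∑ i : Fin d, mollDerivConst (Fin d) (bv i)) / δ *
          Real.sqrt (∑ α ∈ wordsLE (Fin d) m, ‖dcurve h hδ hu₀ hu₀c U α t‖ ^ 2) := by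
  obtain ⟨hm, hle⟩ := l2norm_cwd_cons_smoothRep_flow_le h hδ hu₀ hu₀c hU0 hU j c t
  refine ⟨hm, hle.trans ?_⟩
  have h1 : ‖dcurve h hδ hu₀ hu₀c U c t‖ ^ 2 ≤ ∑ α ∈ wordsLE (Fin d) m, ‖dcurve h hδ hu₀ hu₀c U α t‖ ^ 2 :=
    Finset.single_le_sum (f := fun α => ‖dcurve h hδ hu₀ hu₀c U α t‖ ^ 2) (fun _ _ => sq_nonneg _)
      (mem_wordsLE.2 hc)
  have h2 := Real.abs_le_sqrt h1
  rw [abs_of_nonneg (norm_nonneg _)] at h2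
  exact mul_le_mul (div_le_div_of_nonneg_right (mollDerivConst_le_sum j) hδ.le) h2 (norm_nonneg _)
    (div_nonneg (Finset.sum_nonneg fun i _ => mollDerivConst_nonneg (bv i)) hδ.le)

end Controls

/-! ### The sup bound of `ρ_δ ⋆ F_δ(V)` -/

/-- **`‖(ρ_δ ⋆ F_δ(V))(x)‖ ≤ sup ‖G(ρ_δ ⋆ V)‖`**: `F_δ(V) = -ρ_δ ⋆ G` and mollification by a
probability density does not increase the sup norm. [folklore] -/
theorem norm_smoothRep_regField_le (h : IsTameCoeff M L a b) {δ : ℝ} (hδ : 0 < δ)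
    (V : Lp (EuclideanSpace ℝ (Fin k)) 2 (volume : Measure (EuclideanSpace ℝ (Fin d)))) {C : ℝ}
    (hGc : Continuous (gfield a b (smoothRep (moll (Fin d) hδ) V)))
    (hC : ∀ y, ‖gfield a b (smoothRep (moll (Fin d) hδ) V) y‖ ≤ C) (x : EuclideanSpace ℝ (Fin d)) :
    ‖smoothRep (moll (Fin d) hδ) (regField h hδ V) x‖ ≤ C := by
  set ρ := moll (Fin d) hδ with hρ
  set G := gfield a b (smoothRep ρ V) with hG
  have hGm : MemLp G 2 (volume : Measure (EuclideanSpace ℝ (Fin d))) := (memLp_gfield_smoothRep h hδ V).1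
  have hGl : LocallyIntegrable G (volume : Measure (EuclideanSpace ℝ (Fin d))) := hGm.locallyIntegrable one_le_two
  -- the representative of `F_δ(V)` is `-(ρ ⋆ G)` a.e.
  have hae : ((regField h hδ V : Lp (EuclideanSpace ℝ (Fin k)) 2 (volume : Measure (EuclideanSpace ℝ (Fin d)))) : (EuclideanSpace ℝ (Fin d)) → (EuclideanSpace ℝ (Fin k))) =ᵐ[volume]
      fun y => -(ρ ⋆[lsmul ℝ ℝ, volume] G) y := by
    have h1 := Lp.coeFn_neg (mollL2 hδ (hGm.toLp G) : Lp (EuclideanSpace ℝ (Fin k)) 2 (volume : Measure (EuclideanSpace ℝ (Fin d))))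
    have h2 := coeFn_convL2 (continuous_moll hδ) (hasCompactSupport_moll hδ) (hGm.toLp G)
    rw [convolution_kernel_congr_ae (ρ := ρ) (MemLp.coeFn_toLp hGm)] at h2
    filter_upwards [h1, h2] with y hy1 hy2
    change ((-(mollL2 hδ (hGm.toLp G)) : Lp (EuclideanSpace ℝ (Fin k)) 2 (volume : Measure (EuclideanSpace ℝ (Fin d)))) : (EuclideanSpace ℝ (Fin d)) → (EuclideanSpace ℝ (Fin k))) y = _
    rw [hy1, Pi.neg_apply]
    exact congrArg Neg.neg hy2
  have heq : smoothRep ρ (regField h hδ V) = ρ ⋆[lsmul ℝ ℝ, volume] fun y => -(ρ ⋆[lsmul ℝ ℝ, volume] G) y := by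
    rw [smoothRep_def]
    exact convolution_kernel_congr_ae hae
  have hρG : Continuous (ρ ⋆[lsmul ℝ ℝ, volume] G) :=
    (hasCompactSupport_moll hδ).continuous_convolution_left _ (continuous_moll hδ) hGl
  -- sup bounds through the probability kernel, twice
  have hb1 : ∀ y, ‖(ρ ⋆[lsmul ℝ ℝ, volume] G) y‖ ≤ C := fun y =>
    norm_normed_convolution_le (bump (Fin d) hδ) hGc (fun z _ => hC z)
  rw [heq]
  exact norm_normed_convolution_le (bump (Fin d) hδ) hρG.neg (fun z _ => by
    rw [Pi.neg_apply, norm_neg]; exact hb1 z)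

/-! ### The uniform energy inequality -/

set_option maxHeartbeats 400000 in
/-- **The energy inequality at one time** (all constants explicit). Hypotheses: the coefficient
bounds `K₀, K₁`; the whole-space tame/sup constants `Ca, Ca', Cb, Cs'` of `aⱼ, b, s` at orders
`m`, `q = m - 2(d+1)` and sup radius `R₀ = C_sob^{1/2}` (`CoordWordTameWhole.lean`); a solution of
the regularised equation for `δ ∈ (0,1]`; a time with `E(t) ≤ 1`. Conclusion:
`|⟪S'Y_α, Y_α⟫ + 2⟪S F_δ^{(α)}(U), Y_α⟫| ≤ C E(t)` for `|α| ≤ m`, with `C` independent of `δ`,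
the datum and the time. [cite: Majda1984, Ch. 2 §2.1, Thm 2.1, (2.15)];
[cite: TaylorPDEIII2011, Ch. 16 §1, (1.13)] -/
theorem energy_term_bound_at (hS : IsSymmSmoothCoeff M L a b s) {m q : ℕ} (hq : 1 ≤ q)
    (hmq : m ≤ 2 * q) (hqm : q + 2 * (d + 1) ≤ m)
    {K₀ K₁ R₀ Ca Ca' Cb Cs' : ℝ} (hK₀ : ∀ y, ‖s y‖ ≤ K₀) (hK₁0 : 0 ≤ K₁)
    (hK₁ : ∀ y, ‖fderiv ℝ s y‖ ≤ K₁) (hR₀ : Real.sqrt (supConst (Fin d) (EuclideanSpace ℝ (Fin k))) ≤ R₀)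
    (hCa0 : 0 ≤ Ca) (hCa'0 : 0 ≤ Ca') (hCb0 : 0 ≤ Cb) (hCs'0 : 0 ≤ Cs')
    (hTa : ∀ (j : Fin d) (h : (EuclideanSpace ℝ (Fin d)) → (EuclideanSpace ℝ (Fin k))), ContDiff ℝ ∞ h →
      (∀ c : List (Fin d), 1 ≤ c.length → c.length ≤ q → ∀ x, ‖cwd c h x‖ ≤ R₀) →
      ∀ Y : ℝ, 0 ≤ Y → (∀ c : List (Fin d), 1 ≤ c.length → c.length ≤ m →
        MemLp (cwd c h) 2 (volume : Measure (EuclideanSpace ℝ (Fin d))) ∧ l2norm (cwd c h) ≤ Y) →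
      ∀ v : List (Fin d), 1 ≤ v.length → v.length ≤ m →
        MemLp (cwd v (fun y => a j (h y))) 2 (volume : Measure (EuclideanSpace ℝ (Fin d))) ∧
          l2norm (cwd v (fun y => a j (h y))) ≤ Ca * Y)
    (hSa : ∀ (j : Fin d) (h : (EuclideanSpace ℝ (Fin d)) → (EuclideanSpace ℝ (Fin k))), ContDiff ℝ ∞ h →
      (∀ c : List (Fin d), 1 ≤ c.length → c.length ≤ q → ∀ x, ‖cwd c h x‖ ≤ R₀) →
      ∀ v : List (Fin d), v.length ≤ q → ∀ x, ‖cwd v (fun y => a j (h y)) x‖ ≤ Ca')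
    (hTb : ∀ (h : (EuclideanSpace ℝ (Fin d)) → (EuclideanSpace ℝ (Fin k))), ContDiff ℝ ∞ h →
      (∀ c : List (Fin d), 1 ≤ c.length → c.length ≤ q → ∀ x, ‖cwd c h x‖ ≤ R₀) →
      ∀ Y : ℝ, 0 ≤ Y → (∀ c : List (Fin d), 1 ≤ c.length → c.length ≤ m →
        MemLp (cwd c h) 2 (volume : Measure (EuclideanSpace ℝ (Fin d))) ∧ l2norm (cwd c h) ≤ Y) →
      ∀ v : List (Fin d), 1 ≤ v.length → v.length ≤ m →
        MemLp (cwd v (fun y => b (h y))) 2 (volume : Measure (EuclideanSpace ℝ (Fin d))) ∧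
          l2norm (cwd v (fun y => b (h y))) ≤ Cb * Y)
    (hSs : ∀ (h : (EuclideanSpace ℝ (Fin d)) → (EuclideanSpace ℝ (Fin k))), ContDiff ℝ ∞ h →
      (∀ c : List (Fin d), 1 ≤ c.length → c.length ≤ q → ∀ x, ‖cwd c h x‖ ≤ R₀) →
      ∀ v : List (Fin d), v.length ≤ q → ∀ x, ‖cwd v (fun y => s (h y)) x‖ ≤ Cs')
    {δ : ℝ} (hδ : 0 < δ) (hδ1 : δ ≤ 1) (hu₀ : ContDiff ℝ ∞ u₀) (hu₀c : HasCompactSupport u₀)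
    {U : ℝ → Lp (EuclideanSpace ℝ (Fin k)) 2 (volume : Measure (EuclideanSpace ℝ (Fin d)))} (hU0 : U 0 = dataL2 hu₀ hu₀c)
    (hU : ∀ t, HasDerivAt U (regField hS.toIsTameCoeff hδ (U t)) t) (t : ℝ)
    (hE : ∑ α ∈ wordsLE (Fin d) m, ‖dcurve hS.toIsTameCoeff hδ hu₀ hu₀c U α t‖ ^ 2 ≤ 1)
    {α : List (Fin d)} (hα : α.length ≤ m) :
    |⟪weightOpDeriv hS hδ (U t) (dcurve hS.toIsTameCoeff hδ hu₀ hu₀c U α t),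
        dcurve hS.toIsTameCoeff hδ hu₀ hu₀c U α t⟫ +
      2 * ⟪weightOp hS hδ (U t) (derivedField hS.toIsTameCoeff hδ α (U t)),
        dcurve hS.toIsTameCoeff hδ hu₀ hu₀c U α t⟫| ≤
      (K₁ * ((d * M + L) * R₀) +
        2 * (d * ((K₀ * M + (Cs' * M + K₀ * Ca')) / 2) +
          (d * 2 ^ m * (Ca * R₀ + Ca') + (Cb + L)) * K₀ +
          d * Cs' * (d * M * (∑ i : Fin d, mollDerivConst (Fin d) (bv i)) +
            (d * 2 ^ m * (Ca * R₀ + Ca') + (Cb + L))))) *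
      ∑ β ∈ wordsLE (Fin d) m, ‖dcurve hS.toIsTameCoeff hδ hu₀ hu₀c U β t‖ ^ 2 := by
  -- names
  set ρ := moll (Fin d) hδ with hρ
  set Wt := smoothRep ρ (U t) with hWt
  set G := gfield a b Wt with hG
  set g := cwd α G with hgdef
  set Y := dcurve hS.toIsTameCoeff hδ hu₀ hu₀c U α t with hYdef
  set V := cwd α Wt with hVdef
  obtain ⟨KD, hKD⟩ : ∃ x : ℝ, x = ∑ i : Fin d, mollDerivConst (Fin d) (bv i) := ⟨_, rfl⟩
  obtain ⟨Clow, hClow⟩ : ∃ x : ℝ, x = d * 2 ^ m * (Ca * R₀ + Ca') + (Cb + L) := ⟨_, rfl⟩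
  obtain ⟨MP, hMP⟩ : ∃ x : ℝ, x = K₀ * M + (Cs' * M + K₀ * Ca') := ⟨_, rfl⟩
  obtain ⟨En, hEn⟩ : ∃ x : ℝ, x = ∑ β ∈ wordsLE (Fin d) m,
    ‖dcurve hS.toIsTameCoeff hδ hu₀ hu₀c U β t‖ ^ 2 := ⟨_, rfl⟩
  obtain ⟨Ys, hYs⟩ : ∃ x : ℝ, x = Real.sqrt En := ⟨_, rfl⟩
  rw [← hKD, ← hClow, ← hMP, ← hEn]
  rw [← hEn] at hE
  -- signs
  have hK₀0 : 0 ≤ K₀ := (norm_nonneg _).trans (hK₀ 0)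
  have hM0 : 0 ≤ M := hS.M_nonneg
  have hL0 : 0 ≤ L := hS.L_nonneg
  have hR₀0 : 0 ≤ R₀ := (Real.sqrt_nonneg _).trans hR₀
  have hEn0 : 0 ≤ En := by rw [hEn]; exact Finset.sum_nonneg fun _ _ => sq_nonneg _
  have hYs0 : 0 ≤ Ys := by rw [hYs]; exact Real.sqrt_nonneg _
  have hYs2 : Ys ^ 2 = En := by rw [hYs]; exact Real.sq_sqrt hEn0
  have hd0 : (0 : ℝ) ≤ d := Nat.cast_nonneg d
  have hKD0 : 0 ≤ KD := by rw [hKD]; exact Finset.sum_nonneg fun i _ => mollDerivConst_nonneg (bv i)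
  have hClow0 : 0 ≤ Clow := by rw [hClow]; positivity
  have hMP0 : 0 ≤ MP := by rw [hMP]; positivity
  -- the key identity and smoothness
  have hVY : smoothRep ρ Y = V := smoothRep_dcurve hS.toIsTameCoeff hδ hu₀ hu₀c hU0 hU α t
  have hWs : ContDiff ℝ ∞ Wt := contDiff_smoothRep (contDiff_moll hδ) (hasCompactSupport_moll hδ) _
  have hGs : ContDiff ℝ ∞ G := contDiff_gfield hS hWs
  have hgc : Continuous g := continuous_cwd hGs α
  -- ‖Y‖² ≤ E, ‖Y‖ ≤ Ys
  have hYE : ‖Y‖ ^ 2 ≤ En := by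
    rw [hEn]
    exact Finset.single_le_sum (f := fun β => ‖dcurve hS.toIsTameCoeff hδ hu₀ hu₀c U β t‖ ^ 2)
      (fun _ _ => sq_nonneg _) (mem_wordsLE.2 hα)
  have hYYs : ‖Y‖ ≤ Ys := by
    have h2 := Real.abs_le_sqrt hYE
    rwa [abs_of_nonneg (norm_nonneg _), ← hYs] at h2
  -- controls of `Wt`
  have hsup : ∀ c : List (Fin d), c.length ≤ q → ∀ x, ‖cwd c Wt x‖ ≤ R₀ := by
    intro c hc x
    have h1 := norm_cwd_smoothRep_flow_le_sqrt hS.toIsTameCoeff hδ hu₀ hu₀c hU0 hU c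
      (m := m) (by omega) t x
    rw [← hEn] at h1
    refine h1.trans (le_trans ?_ hR₀)
    refine Real.sqrt_le_sqrt ?_
    exact mul_le_of_le_one_right supConst_nonneg hE
  have hsup1 : ∀ c : List (Fin d), 1 ≤ c.length → c.length ≤ q → ∀ x, ‖cwd c Wt x‖ ≤ R₀ :=
    fun c _ hc x => hsup c hc x
  have hL2 : ∀ c : List (Fin d), c.length ≤ m →
      MemLp (cwd c Wt) 2 (volume : Measure (EuclideanSpace ℝ (Fin d))) ∧ l2norm (cwd c Wt) ≤ Ys := by
    intro c hc
    have h1 := l2norm_cwd_smoothRep_flow_le_sqrt hS.toIsTameCoeff hδ hu₀ hu₀c hU0 hU c hc t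
    rw [← hEn, ← hYs] at h1
    exact h1
  have hL21 : ∀ c : List (Fin d), 1 ≤ c.length → c.length ≤ m →
      MemLp (cwd c Wt) 2 (volume : Measure (EuclideanSpace ℝ (Fin d))) ∧ l2norm (cwd c Wt) ≤ Ys :=
    fun c _ hc => hL2 c hc
  have hL2' : ∀ (j : Fin d) (c : List (Fin d)), c.length ≤ m →
      MemLp (cwd (j :: c) Wt) 2 (volume : Measure (EuclideanSpace ℝ (Fin d))) ∧ l2norm (cwd (j :: c) Wt) ≤ KD / δ * Ys := by
    intro j c hc
    have h1 := l2norm_cwd_cons_smoothRep_flow_le_sqrt hS.toIsTameCoeff hδ hu₀ hu₀c hU0 hU j c hc t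
    rw [← hKD, ← hEn, ← hYs] at h1
    exact h1
  -- tame/sup constants instantiated on `Wt`
  have hTa' : ∀ (j : Fin d) (v : List (Fin d)), 1 ≤ v.length → v.length ≤ m →
      MemLp (cwd v (fun y => a j (Wt y))) 2 (volume : Measure (EuclideanSpace ℝ (Fin d))) ∧
        l2norm (cwd v (fun y => a j (Wt y))) ≤ Ca * Ys :=
    fun j => hTa j Wt hWs hsup1 Ys hYs0 hL21
  have hSa' : ∀ (j : Fin d) (v : List (Fin d)), v.length ≤ q → ∀ x,
      ‖cwd v (fun y => a j (Wt y)) x‖ ≤ Ca' := fun j => hSa j Wt hWs hsup1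
  have hTb' : ∀ v : List (Fin d), 1 ≤ v.length → v.length ≤ m →
      MemLp (cwd v (fun y => b (Wt y))) 2 (volume : Measure (EuclideanSpace ℝ (Fin d))) ∧
        l2norm (cwd v (fun y => b (Wt y))) ≤ Cb * Ys := hTb Wt hWs hsup1 Ys hYs0 hL21
  have hSs' : ∀ v : List (Fin d), v.length ≤ q → ∀ x, ‖cwd v (fun y => s (Wt y)) x‖ ≤ Cs' :=
    hSs Wt hWs hsup1
  -- (A) the weight-derivative term
  have hGsup : ∀ y, ‖G y‖ ≤ (d * M + L) * R₀ := fun y =>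
    norm_gfield_le hS (fun x => by simpa using hsup [] (by simp) x) (fun j x => hsup [j] (by simpa using hq) x) y
  have hRF : ∀ x, ‖smoothRep ρ (regField hS.toIsTameCoeff hδ (U t)) x‖ ≤ (d * M + L) * R₀ :=
    norm_smoothRep_regField_le hS.toIsTameCoeff hδ (U t) hGs.continuous hGsup
  have hA : |⟪weightOpDeriv hS hδ (U t) Y, Y⟫| ≤ K₁ * ((d * M + L) * R₀) * En := by
    calc |⟪weightOpDeriv hS hδ (U t) Y, Y⟫| ≤ ‖weightOpDeriv hS hδ (U t) Y‖ * ‖Y‖ :=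
          abs_real_inner_le_norm _ _
      _ ≤ K₁ * ((d * M + L) * R₀) * ‖Y‖ * ‖Y‖ :=
          mul_le_mul_of_nonneg_right (norm_weightOpDeriv_apply_le_of_sup hS hδ hK₁0 hK₁ (U t) hRF Y)
            (norm_nonneg _)
      _ = K₁ * ((d * M + L) * R₀) * ‖Y‖ ^ 2 := by ring
      _ ≤ K₁ * ((d * M + L) * R₀) * En := mul_le_mul_of_nonneg_left hYE (by positivity)
  -- `L²` bound of `g = ∂_α G`
  obtain ⟨hg2, hgle⟩ := memLp_cwd_gfield hS hWs hmq hR₀0 hYs0 hCa0 hCa'0 hCb0 hsup hL2 hL2' hTa' hSa'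
    hTb' hα
  rw [← hClow] at hgle
  -- (B1) the commutator term
  have hLs : ∀ x, ‖fderiv ℝ (fun y => s (Wt y)) x‖ ≤ d * Cs' := fun x =>
    norm_fderiv_comp_le_of_cwd (fun j y => hSs' [j] (by simpa using hq) y) x
  have hB1 : |∫ x, ⟪(ρ ⋆[lsmul ℝ ℝ, volume] fun y => s (Wt y) (g y)) x -
      s (Wt x) ((ρ ⋆[lsmul ℝ ℝ, volume] g) x), (Y : (EuclideanSpace ℝ (Fin d)) → (EuclideanSpace ℝ (Fin k))) x⟫| ≤
      d * Cs' * (d * M * KD + Clow) * En := by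
    refine (abs_integral_commutator_le hS hδ hWs hK₀ hLs hgc hg2 Y).trans ?_
    have h1 : δ * (d * Cs') * l2norm g * ‖Y‖ ≤ δ * (d * Cs') * ((d * M * (KD / δ) + Clow) * Ys) * Ys :=
      mul_le_mul (mul_le_mul_of_nonneg_left hgle (by positivity)) hYYs (norm_nonneg _) (by positivity)
    refine h1.trans ?_
    have hδK : δ * (KD / δ) = KD := mul_div_cancel₀ KD hδ.ne'
    have h2 : δ * (d * Cs') * ((d * M * (KD / δ) + Clow) * Ys) * Ys =
        d * Cs' * (d * M * KD + δ * Clow) * En := by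
      calc δ * (d * Cs') * ((d * M * (KD / δ) + Clow) * Ys) * Ys
          = d * Cs' * (d * M * (δ * (KD / δ)) + δ * Clow) * (Ys ^ 2) := by ring
        _ = d * Cs' * (d * M * KD + δ * Clow) * En := by rw [hδK, hYs2]
    rw [h2]
    have h3 : δ * Clow ≤ Clow := mul_le_of_le_one_left hClow0 hδ1
    have h4 : d * Cs' * (d * M * KD + δ * Clow) ≤ d * Cs' * (d * M * KD + Clow) :=
      mul_le_mul_of_nonneg_left (by linarith) (by positivity)
    exact mul_le_mul_of_nonneg_right h4 hEn0
  -- (B2) the main term: split into top and lower parts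
  obtain ⟨r, hr1, hr, heq⟩ := cwd_gfield_split hS hWs α
  obtain ⟨hmL, hleL⟩ := memLp_low_part hS hWs hmq hR₀0 hYs0 hCa0 hCa'0 hCb0 hsup hL2 hTa' hSa' hTb'
    hα hr1 hr
  rw [← hClow] at hleL
  have hV2 : MemLp V 2 (volume : Measure (EuclideanSpace ℝ (Fin d))) ∧ l2norm V ≤ Ys := hL2 α hα
  have hVc : Continuous V := continuous_cwd hWs α
  have hVn : l2norm V ≤ ‖Y‖ := by
    have := (l2norm_cwd_smoothRep_flow_le hS.toIsTameCoeff hδ hu₀ hu₀c hU0 hU α t).2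
    exact this
  have hsV : MemLp (fun x => s (Wt x) (V x)) 2 (volume : Measure (EuclideanSpace ℝ (Fin d))) :=
    (memLp_clm_apply_and_l2norm_le ((contDiff_s_comp hS hWs).continuous) hVc hV2.1 hK₀0
      (fun x => hK₀ _)).1
  have htop : ∀ j : Fin d, MemLp (fun x => a j (Wt x) (cwd α (cwd [j] Wt) x)) 2 (volume : Measure (EuclideanSpace ℝ (Fin d))) :=
    fun j => (memLp_top_term hS hWs hL2' j hα).1
  -- the integral of the split
  have hint_top : ∀ j : Fin d, Integrable (fun x => ⟪a j (Wt x) (cwd α (cwd [j] Wt) x), s (Wt x) (V x)⟫)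
      (volume : Measure (EuclideanSpace ℝ (Fin d))) := fun j => integrable_inner_of_memLp (htop j) hsV
  have hint_low : Integrable (fun x => ⟪(∑ j, (r.map fun p => (cwd p.1 (fun y => a j (Wt y)) x)
      (cwd p.2 (cwd [j] Wt) x)).sum) + cwd α (fun y => b (Wt y)) x, s (Wt x) (V x)⟫)
      (volume : Measure (EuclideanSpace ℝ (Fin d))) := integrable_inner_of_memLp hmL hsV
  have hsplit : ∫ x, ⟪g x, s (Wt x) (V x)⟫ =
      (∑ j, ∫ x, ⟪a j (Wt x) (cwd α (cwd [j] Wt) x), s (Wt x) (V x)⟫) +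
        ∫ x, ⟪(∑ j, (r.map fun p => (cwd p.1 (fun y => a j (Wt y)) x)
          (cwd p.2 (cwd [j] Wt) x)).sum) + cwd α (fun y => b (Wt y)) x, s (Wt x) (V x)⟫ := by
    rw [← integral_finsetSum _ (fun j _ => hint_top j), ← integral_add
      (integrable_finsetSum _ fun j _ => hint_top j) hint_low]
    refine integral_congr_ae (Eventually.of_forall fun x => ?_)
    change ⟪g x, s (Wt x) (V x)⟫ = _
    rw [hgdef, heq]
    simp only [inner_add_left, sum_inner]
  -- bounds of the pieces
  have hCs1 : ∀ (j : Fin d) (x : EuclideanSpace ℝ (Fin d)), ‖cwd [j] (fun y => s (Wt y)) x‖ ≤ Cs' :=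
    fun j x => hSs' [j] (by simpa using hq) x
  have hCa1 : ∀ (j : Fin d) (x : EuclideanSpace ℝ (Fin d)), ‖cwd [j] (fun y => a j (Wt y)) x‖ ≤ Ca' :=
    fun j x => hSa' j [j] (by simpa using hq) x
  have hl2V : l2norm (cwd α Wt) ^ 2 ≤ En :=
    (pow_le_pow_left₀ (l2norm_nonneg _) hVn 2).trans hYE
  have htopb : ∀ j : Fin d, |∫ x, ⟪a j (Wt x) (cwd α (cwd [j] Wt) x), s (Wt x) (V x)⟫| ≤ MP / 2 * En := by
    intro j
    have h1 := abs_integral_top_le hS hWs hK₀ j (hCs1 j) (hCa1 j) (hL2 α hα).1 (hL2' j α hα).1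
    rw [← hMP] at h1
    exact h1.trans (mul_le_mul_of_nonneg_left hl2V (div_nonneg hMP0 (by norm_num)))
  have hlowb : |∫ x, ⟪(∑ j, (r.map fun p => (cwd p.1 (fun y => a j (Wt y)) x)
      (cwd p.2 (cwd [j] Wt) x)).sum) + cwd α (fun y => b (Wt y)) x, s (Wt x) (V x)⟫| ≤
      Clow * K₀ * En := by
    refine (abs_integral_inner_s_le hS hWs hK₀ hmL hVc hV2.1).trans ?_
    calc l2norm (fun x => (∑ j, (r.map fun p => (cwd p.1 (fun y => a j (Wt y)) x)
          (cwd p.2 (cwd [j] Wt) x)).sum) + cwd α (fun y => b (Wt y)) x) * (K₀ * l2norm V)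
        ≤ (Clow * Ys) * (K₀ * Ys) :=
          mul_le_mul hleL (mul_le_mul_of_nonneg_left hV2.2 hK₀0)
            (mul_nonneg hK₀0 (l2norm_nonneg _)) (mul_nonneg hClow0 hYs0)
      _ = Clow * K₀ * En := by rw [← hYs2]; ring
  have hmain : |∫ x, ⟪g x, s (Wt x) (V x)⟫| ≤ (d * (MP / 2) + Clow * K₀) * En := by
    rw [hsplit]
    refine (abs_add_le _ _).trans ?_
    have hsum : |∑ j, ∫ x, ⟪a j (Wt x) (cwd α (cwd [j] Wt) x), s (Wt x) (V x)⟫| ≤ d * (MP / 2 * En) := by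
      refine (Finset.abs_sum_le_sum_abs _ _).trans ?_
      calc ∑ j, |∫ x, ⟪a j (Wt x) (cwd α (cwd [j] Wt) x), s (Wt x) (V x)⟫|
          ≤ ∑ _j : Fin d, MP / 2 * En := Finset.sum_le_sum fun j _ => htopb j
        _ = d * (MP / 2 * En) := by simp
    calc |∑ j, ∫ x, ⟪a j (Wt x) (cwd α (cwd [j] Wt) x), s (Wt x) (V x)⟫| +
          |∫ x, ⟪(∑ j, (r.map fun p => (cwd p.1 (fun y => a j (Wt y)) x)
            (cwd p.2 (cwd [j] Wt) x)).sum) + cwd α (fun y => b (Wt y)) x, s (Wt x) (V x)⟫|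
        ≤ d * (MP / 2 * En) + Clow * K₀ * En := add_le_add hsum hlowb
      _ = (d * (MP / 2) + Clow * K₀) * En := by ring
  -- (B) assembled
  have hB : |⟪weightOp hS hδ (U t) (derivedField hS.toIsTameCoeff hδ α (U t)), Y⟫| ≤
      (d * (MP / 2) + Clow * K₀ + d * Cs' * (d * M * KD + Clow)) * En := by
    rw [inner_weightOp_derivedField_eq hS hδ hu₀ hu₀c hU0 hU α t hK₀ hLs hg2]
    refine (abs_add_le _ _).trans ?_
    rw [abs_neg]
    calc |∫ x, ⟪g x, s (Wt x) (V x)⟫| + |∫ x, ⟪(ρ ⋆[lsmul ℝ ℝ, volume] fun y => s (Wt y) (g y)) x -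
          s (Wt x) ((ρ ⋆[lsmul ℝ ℝ, volume] g) x), (Y : (EuclideanSpace ℝ (Fin d)) → (EuclideanSpace ℝ (Fin k))) x⟫|
        ≤ (d * (MP / 2) + Clow * K₀) * En + d * Cs' * (d * M * KD + Clow) * En := add_le_add hmain hB1
      _ = (d * (MP / 2) + Clow * K₀ + d * Cs' * (d * M * KD + Clow)) * En := by ring
  -- total
  calc |⟪weightOpDeriv hS hδ (U t) Y, Y⟫ +
        2 * ⟪weightOp hS hδ (U t) (derivedField hS.toIsTameCoeff hδ α (U t)), Y⟫|
      ≤ |⟪weightOpDeriv hS hδ (U t) Y, Y⟫| +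
          |2 * ⟪weightOp hS hδ (U t) (derivedField hS.toIsTameCoeff hδ α (U t)), Y⟫| := abs_add_le _ _
    _ = |⟪weightOpDeriv hS hδ (U t) Y, Y⟫| +
          2 * |⟪weightOp hS hδ (U t) (derivedField hS.toIsTameCoeff hδ α (U t)), Y⟫| := by
        rw [abs_mul, abs_two]
    _ ≤ K₁ * ((d * M + L) * R₀) * En +
          2 * ((d * (MP / 2) + Clow * K₀ + d * Cs' * (d * M * KD + Clow)) * En) :=
        add_le_add hA (mul_le_mul_of_nonneg_left hB (by norm_num))
    _ = (K₁ * ((d * M + L) * R₀) +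
          2 * (d * (MP / 2) + Clow * K₀ + d * Cs' * (d * M * KD + Clow))) * En := by ring

/-- **The uniform-in-`δ` energy inequality.** For smooth symmetrizable tame coefficients and an
order `m ≥ 4(d+1)` there is `C ≥ 0` such that for EVERY `δ ∈ (0, 1]`, every smooth compactly
supported datum, every solution `U : ℝ → L²` of the regularised equation `U' = F_δ(U)` issued from
it, every time `t` with `E(t) = Σ_{|α| ≤ m} ‖Y_α(t)‖² ≤ 1` and every `|α| ≤ m`:
`|⟪S'Y_α, Y_α⟫ + 2⟪S F_δ^{(α)}(U), Y_α⟫| ≤ C · E(t)` — the time derivative of each weighted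
energy summand (`hasDerivAt_weightedTerm`) is controlled by the energy, uniformly in the
regularisation. [cite: Majda1984, Ch. 2 §2.1, Thm 2.1, (2.15)];
[cite: TaylorPDEIII2011, Ch. 16 §1, (1.13)] -/
theorem exists_energy_deriv_bound (hS : IsSymmSmoothCoeff M L a b s) {m : ℕ}
    (hm : 4 * (d + 1) ≤ m) :
    ∃ C : ℝ, 0 ≤ C ∧ ∀ {δ : ℝ} (hδ : 0 < δ), δ ≤ 1 →
      ∀ (hu₀ : ContDiff ℝ ∞ u₀) (hu₀c : HasCompactSupport u₀)
        {U : ℝ → Lp (EuclideanSpace ℝ (Fin k)) 2 (volume : Measure (EuclideanSpace ℝ (Fin d)))}, U 0 = dataL2 hu₀ hu₀c →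
        (∀ t, HasDerivAt U (regField hS.toIsTameCoeff hδ (U t)) t) → ∀ t : ℝ,
        ∑ α ∈ wordsLE (Fin d) m, ‖dcurve hS.toIsTameCoeff hδ hu₀ hu₀c U α t‖ ^ 2 ≤ 1 →
        ∀ α : List (Fin d), α.length ≤ m →
          |⟪weightOpDeriv hS hδ (U t) (dcurve hS.toIsTameCoeff hδ hu₀ hu₀c U α t),
              dcurve hS.toIsTameCoeff hδ hu₀ hu₀c U α t⟫ +
            2 * ⟪weightOp hS hδ (U t) (derivedField hS.toIsTameCoeff hδ α (U t)),
              dcurve hS.toIsTameCoeff hδ hu₀ hu₀c U α t⟫| ≤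
          C * ∑ β ∈ wordsLE (Fin d) m, ‖dcurve hS.toIsTameCoeff hδ hu₀ hu₀c U β t‖ ^ 2 := by
  -- orders
  set q : ℕ := m - 2 * (d + 1) with hqdef
  have hq : 1 ≤ q := by omega
  have hmq : m ≤ 2 * q := by omega
  have hqm : q + 2 * (d + 1) ≤ m := by omega
  have hmq' : m ≤ 2 * q + 1 := by omega
  -- coefficient constants
  obtain ⟨K₀, -, hK₀⟩ := hS.exists_norm_s_le
  obtain ⟨K₁, hK₁0, hK₁⟩ := hS.exists_norm_fderiv_s_le
  set R₀ : ℝ := Real.sqrt (supConst (Fin d) (EuclideanSpace ℝ (Fin k))) with hR₀def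
  -- tame and sup constants
  have hTa0 := fun j : Fin d =>
    exists_tame_bound_cwd_comp_whole (ι := Fin d) m (hS.smooth_a j) (hS.bdd_a j) q hmq' R₀
  choose Ca hCa0 hCa using hTa0
  have hSa0 := fun j : Fin d =>
    exists_sup_bound_cwd_comp_whole (ι := Fin d) q (hS.smooth_a j) (hS.bdd_a j) R₀
  choose Ca' hCa'0 hCa' using hSa0
  obtain ⟨Cb, hCb0, hCb⟩ :=
    exists_tame_bound_cwd_comp_whole (ι := Fin d) m hS.smooth_b hS.bdd_b q hmq' R₀
  obtain ⟨Cs', hCs'0, hCs'⟩ := exists_sup_bound_cwd_comp_whole (ι := Fin d) q hS.smooth_s hS.bdd_s R₀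
  set CA : ℝ := ∑ j, Ca j with hCA
  set CA' : ℝ := ∑ j, Ca' j with hCA'
  have hCA0 : 0 ≤ CA := Finset.sum_nonneg fun j _ => hCa0 j
  have hCA'0 : 0 ≤ CA' := Finset.sum_nonneg fun j _ => hCa'0 j
  have hleA : ∀ j, Ca j ≤ CA := fun j =>
    Finset.single_le_sum (f := Ca) (fun i _ => hCa0 i) (Finset.mem_univ j)
  have hleA' : ∀ j, Ca' j ≤ CA' := fun j =>
    Finset.single_le_sum (f := Ca') (fun i _ => hCa'0 i) (Finset.mem_univ j)
  -- the uniform specs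
  have hTa : ∀ (j : Fin d) (h : (EuclideanSpace ℝ (Fin d)) → (EuclideanSpace ℝ (Fin k))), ContDiff ℝ ∞ h →
      (∀ c : List (Fin d), 1 ≤ c.length → c.length ≤ q → ∀ x, ‖cwd c h x‖ ≤ R₀) →
      ∀ Y : ℝ, 0 ≤ Y → (∀ c : List (Fin d), 1 ≤ c.length → c.length ≤ m →
        MemLp (cwd c h) 2 (volume : Measure (EuclideanSpace ℝ (Fin d))) ∧ l2norm (cwd c h) ≤ Y) →
      ∀ v : List (Fin d), 1 ≤ v.length → v.length ≤ m →
        MemLp (cwd v (fun y => a j (h y))) 2 (volume : Measure (EuclideanSpace ℝ (Fin d))) ∧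
          l2norm (cwd v (fun y => a j (h y))) ≤ CA * Y := by
    intro j h hh hsupc Y hY hL2c v hv1 hv
    obtain ⟨hm', hle'⟩ := hCa j h hh hsupc Y hY hL2c v hv1 hv
    exact ⟨hm', hle'.trans (mul_le_mul_of_nonneg_right (hleA j) hY)⟩
  have hSa : ∀ (j : Fin d) (h : (EuclideanSpace ℝ (Fin d)) → (EuclideanSpace ℝ (Fin k))), ContDiff ℝ ∞ h →
      (∀ c : List (Fin d), 1 ≤ c.length → c.length ≤ q → ∀ x, ‖cwd c h x‖ ≤ R₀) →
      ∀ v : List (Fin d), v.length ≤ q → ∀ x, ‖cwd v (fun y => a j (h y)) x‖ ≤ CA' :=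
    fun j h hh hsupc v hv x => (hCa' j h hh hsupc v hv x).trans (hleA' j)
  refine ⟨K₁ * ((d * M + L) * R₀) +
      2 * (d * ((K₀ * M + (Cs' * M + K₀ * CA')) / 2) +
        (d * 2 ^ m * (CA * R₀ + CA') + (Cb + L)) * K₀ +
        d * Cs' * (d * M * (∑ i : Fin d, mollDerivConst (Fin d) (bv i)) +
          (d * 2 ^ m * (CA * R₀ + CA') + (Cb + L)))), ?_, ?_⟩
  · have hK₀0 : 0 ≤ K₀ := (norm_nonneg _).trans (hK₀ 0)
    have hM0 : 0 ≤ M := hS.M_nonneg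
    have hL0 : 0 ≤ L := hS.L_nonneg
    have hR₀0 : 0 ≤ R₀ := Real.sqrt_nonneg _
    have hKD0 : 0 ≤ ∑ i : Fin d, mollDerivConst (Fin d) (bv i) :=
      Finset.sum_nonneg fun i _ => mollDerivConst_nonneg (bv i)
    positivity
  · intro δ hδ hδ1 hu₀ hu₀c U hU0 hU t hE α hα
    exact energy_term_bound_at hS hq hmq hqm hK₀ hK₁0 hK₁ le_rfl hCA0 hCA'0 hCb0 hCs'0 hTa hSa
      hCb hCs' hδ hδ1 hu₀ hu₀c hU0 hU t hE hα

end Literature.Barriers.AtomisticToContinuum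

end
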